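import Summits.CriticalPhenomena.PercolationContinuityZ3.Theorems.PercNearOneGluingNoHeavyQuantThreePortHTilesQuarterA
import Summits.CriticalPhenomena.PercolationContinuityZ3.Theorems.PercNearOneGluingNoHeavyQuantThreePortHTilesQuarterB
import Summits.CriticalPhenomena.PercolationContinuityZ3.Theorems.PercNearOneGluingNoHeavyQuantThreePortProductRow
import HarnessLib

/-!
# `Z(3,2)` AT EVERY THREE-PORT OBSERVER FROM H_{1/4}, AND FROM THE PRODUCT ROW `P(a↔b↔c)·P(a|b|c) ≤ 3·P(exactly one)`

builds on p205010 (kernel theorem, internal audit signed; external expert review pending)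

Support file (`--supports stmt-CriticalPhenomena-4575`), seat `prim-quant-p1` (gen 39); memo
`run/shared/lean/prim/quant/prim-quant-p1-g39/FOR-LEAD-Z32-HCOLLAR.md` §7.  No definitions, no named facts, no sorries; standard axioms.

The κ₀ = 1/4 version of `…QuantThreePortHCollar` (κ₀ = 1/3, `le_one_reached_le_of_H`): the same four-row cell solver on the collar with the
finer tiling `hCollar_tile_false_quarter_lo/hi` (172 leaves, `…QuantThreePortHTilesQuarterA/B`).  WHY: in the two-configuration surgery
framework of the memo (§7) a cover of `T × N` (all joined × pairwise separated) by `k` stable swap rules proves the product row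
`U3·U0 ≤ k·(Uab+Uac)`, which implies the linear row H_{1/(1+k)}; the six whole-cluster implant rules need `k = 3` on ≤ 4 vertices (and
fail on 6), so `k = 3`, i.e. H_{1/4}, is the natural endpoint to have in the tree: **a three-rule cover would make the three-port case of
`Z(3,2)` unconditional through this file.**  The pointwise limit of the chain is `κ ≈ 0.18`; `κ₀ = 1/5` does not tile.
* `hCollar_tile_false_quarter`, `hCollar_residual_false_sorted_quarter_quarter`, `hCollar_residual_false_quarter` — real algebra, `κ ≥ 1/4`.
* **`le_one_reached_le_of_H_quarter`** — `Z(3,2)` at every three-port observer from the three rows H_κ, `κ ≥ 1/4`.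
* **`le_one_reached_le_of_productRow3`** — the same from the product rows `U3·U0 ≤ C·(two "exactly one" cells)`, `C ≤ 3`, at the three apexes
  (`hRow_quarter_of_productRow3`: `(S+U3)(S+U0) ≤ S + U3·U0 ≤ 4S`).
[cite: Gladkov2024, Thm. 1.3 (p. 2), Conj. 10.1 (p. 18), arXiv:2408.08457] (context).
-/

noncomputable section

namespace Summit.CriticalPhenomena.PercolationContinuityZ3.Theorems

open MeasureTheory Set Literature.Probability.LatticeModels Literature.Probability.Percolation
open scoped Classical BigOperators

variable {n : ℕ}

namespace ThreePort

/-! ### Pure real algebra: the collar at κ₀ = 1/4 -/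

/-- **The collar tile at κ₀ = 1/4** (parts A: `β ≤ 1/4` and B: `β ≥ 1/4`). [this work] -/
theorem hCollar_tile_false_quarter (κ α β γ U0 Uab Uac Ubc U3 : ℝ) (hκ : 1 / 4 ≤ κ)
    (a1 : 2 / 5 ≤ α) (a2 : α ≤ 1 / 2) (b1 : 0 ≤ β) (b2 : β ≤ 1 / 2) (c1 : 0 ≤ γ) (c2 : γ ≤ 3 / 10)
    (hcb : γ ≤ β) (hVa : β + γ - β * γ - α < 1 / 40)
    (h0 : 0 ≤ U0) (hab : 0 ≤ Uab) (hac : 0 ≤ Uac) (hbc : 0 ≤ Ubc) (h3 : 0 ≤ U3)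
    (hsum : Uab + Uac + Ubc + U3 + U0 = 1)
    (gb : U0 * ((1 - β) * α * γ - β * (1 - α) * (1 - γ)) + Uac * (α + γ - α * γ - β) < 0)
    (gc : U0 * ((1 - γ) * α * β - γ * (1 - α) * (1 - β)) + Uab * (α + β - α * β - γ) < 0)
    (hHa : κ * (Uab + Uac + U3) * (U0 + Uab + Uac) ≤ Uab + Uac)
    (hSig : 2 < (α + β + γ) + (α + β - 2 * α * β) * Uab + (α + γ - 2 * α * γ) * Uac + (β + γ - 2 * β * γ) * Ubc +
      ((1 - α) * (β + γ - β * γ) + (1 - β) * (α + γ - α * γ) + (1 - γ) * (α + β - α * β)) * U3) : False := by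
  rcases le_total β (1 / 4) with hb | hb
  · exact hCollar_tile_false_quarter_lo κ α β γ U0 Uab Uac Ubc U3 hκ a1 a2 b1 hb c1 c2 hcb h0 hab hac hbc h3 hsum gb gc hHa hSig
  · exact hCollar_tile_false_quarter_hi κ α β γ U0 Uab Uac Ubc U3 hκ a1 a2 hb b2 c1 c2 hcb hVa h0 hab hac hbc h3 hsum gb gc hHa
      hSig


/-- **Sorted frame.**  `γ ≤ β ≤ α ≤ ½` with the collar conditions in symmetric form (some hair `> 2/5`, some hair `< 3/10`, some
margin `< 1/40` — in the sorted frame these are `α > 2/5`, `γ < 3/10`, `V_a < 1/40` since `V_a ≤ V_b ≤ V_c`): cells, the failed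
exchanges at `b, c`, H_κ at `a` (`κ ≥ 1/4`) and `Σ > 2` are contradictory (`hCollar_tile_false_quarter`). [this work] -/
theorem hCollar_residual_false_sorted_quarter (κ α β γ U0 Uab Uac Ubc U3 : ℝ) (hκ : 1 / 4 ≤ κ)
    (hα1 : α ≤ 1 / 2) (hγ0 : 0 ≤ γ) (hba : β ≤ α) (hcb : γ ≤ β)
    (hbig : 2 / 5 < α ∨ 2 / 5 < β ∨ 2 / 5 < γ) (hsmall : α < 3 / 10 ∨ β < 3 / 10 ∨ γ < 3 / 10)
    (hmargin : β + γ - β * γ < α + 1 / 40 ∨ α + γ - α * γ < β + 1 / 40 ∨ α + β - α * β < γ + 1 / 40)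
    (h0 : 0 ≤ U0) (hab : 0 ≤ Uab) (hac : 0 ≤ Uac) (hbc : 0 ≤ Ubc) (h3 : 0 ≤ U3)
    (hsum : Uab + Uac + Ubc + U3 + U0 = 1)
    (gb : U0 * ((1 - β) * α * γ - β * (1 - α) * (1 - γ)) + Uac * (α + γ - α * γ - β) < 0)
    (gc : U0 * ((1 - γ) * α * β - γ * (1 - α) * (1 - β)) + Uab * (α + β - α * β - γ) < 0)
    (hHa : κ * (Uab + Uac + U3) * (U0 + Uab + Uac) ≤ Uab + Uac)
    (hSig : 2 < (α + β + γ) + (α + β - 2 * α * β) * Uab + (α + γ - 2 * α * γ) * Uac + (β + γ - 2 * β * γ) * Ubc +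
      ((1 - α) * (β + γ - β * γ) + (1 - β) * (α + γ - α * γ) + (1 - γ) * (α + β - α * β)) * U3) : False := by
  have a1 : 2 / 5 ≤ α := by rcases hbig with h | h | h <;> linarith only [h, hba, hcb]
  have c2 : γ ≤ 3 / 10 := by rcases hsmall with h | h | h <;> linarith only [h, hba, hcb]
  have hVa : β + γ - β * γ - α < 1 / 40 := by
    rcases hmargin with h | h | h
    · linarith only [h]
    · -- `V_b − V_a = (α − β)(2 − γ)`
      have : 0 ≤ (α - β) * (2 - γ) := mul_nonneg (by linarith only [hba]) (by linarith only [hcb, hba, hα1])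
      nlinarith only [h, this]
    · -- `V_c − V_a = (α − γ)(2 − β)`
      have : 0 ≤ (α - γ) * (2 - β) := mul_nonneg (by linarith only [hba, hcb]) (by linarith only [hba, hα1])
      nlinarith only [h, this]
  exact hCollar_tile_false_quarter κ α β γ U0 Uab Uac Ubc U3 hκ a1 hα1 (hγ0.trans hcb) (hba.trans hα1) hγ0 c2 hcb hVa h0 hab hac
    hbc h3 hsum gb gc hHa hSig

/-- **Pure real algebra on the whole collar** (hairs in `[0, ½]`, some hair `> 2/5`, some `< 3/10`, some margin `< 1/40`): nonnegative
cells summing to `1`, the three failed exchanges, the three linear three-cluster rows H_κ (`κ ≥ 1/4`, `a`-dictionary of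
`le_one_reached_le_of_cellSolverH`) and `Σ_v μ(o↔v) > 2` are contradictory: relabel so that the hairs are sorted. [this work] -/
theorem hCollar_residual_false_quarter (κ α β γ U0 Uab Uac Ubc U3 : ℝ) (hκ : 1 / 4 ≤ κ)
    (hα0 : 0 ≤ α) (hα1 : α ≤ 1 / 2) (hβ0 : 0 ≤ β) (hβ1 : β ≤ 1 / 2) (hγ0 : 0 ≤ γ) (hγ1 : γ ≤ 1 / 2)
    (hbig : 2 / 5 < α ∨ 2 / 5 < β ∨ 2 / 5 < γ) (hsmall : α < 3 / 10 ∨ β < 3 / 10 ∨ γ < 3 / 10)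
    (hmargin : β + γ - β * γ < α + 1 / 40 ∨ α + γ - α * γ < β + 1 / 40 ∨ α + β - α * β < γ + 1 / 40)
    (h0 : 0 ≤ U0) (hab : 0 ≤ Uab) (hac : 0 ≤ Uac) (hbc : 0 ≤ Ubc) (h3 : 0 ≤ U3)
    (hsum : Uab + Uac + Ubc + U3 + U0 = 1)
    (ga : U0 * ((1 - α) * β * γ - α * (1 - β) * (1 - γ)) + Ubc * (β + γ - β * γ - α) < 0)
    (gb : U0 * ((1 - β) * α * γ - β * (1 - α) * (1 - γ)) + Uac * (α + γ - α * γ - β) < 0)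
    (gc : U0 * ((1 - γ) * α * β - γ * (1 - α) * (1 - β)) + Uab * (α + β - α * β - γ) < 0)
    (hHa : κ * (Uab + Uac + U3) * (U0 + Uab + Uac) ≤ Uab + Uac)
    (hHb : κ * (Uab + Ubc + U3) * (U0 + Uab + Ubc) ≤ Uab + Ubc)
    (hHc : κ * (Uac + Ubc + U3) * (U0 + Uac + Ubc) ≤ Uac + Ubc)
    (hSig : 2 < (α + β + γ) + (α + β - 2 * α * β) * Uab + (α + γ - 2 * α * γ) * Uac + (β + γ - 2 * β * γ) * Ubc +
      ((1 - α) * (β + γ - β * γ) + (1 - β) * (α + γ - α * γ) + (1 - γ) * (α + β - α * β)) * U3) : False := by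
  rcases le_total β α with hβα | hαβ
  · rcases le_total γ β with hγβ | hβγ
    · -- `γ ≤ β ≤ α`: identity
      exact hCollar_residual_false_sorted_quarter κ α β γ U0 Uab Uac Ubc U3 hκ hα1 hγ0 hβα hγβ hbig hsmall hmargin h0 hab hac hbc
        h3 hsum gb gc hHa hSig
    · rcases le_total γ α with hγα | hαγ
      · -- `β ≤ γ ≤ α`: roles `(a, c, b)`
        have hm : γ + β - γ * β < α + 1 / 40 ∨ α + β - α * β < γ + 1 / 40 ∨ α + γ - α * γ < β + 1 / 40 := by
          rcases hmargin with h | h | h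
          · exact Or.inl (by linarith only [h])
          · exact Or.inr (Or.inr h)
          · exact Or.inr (Or.inl h)
        exact hCollar_residual_false_sorted_quarter κ α γ β U0 Uac Uab Ubc U3 hκ hα1 hβ0 hγα hβγ (hbig.imp_right Or.symm)
          (hsmall.imp_right Or.symm) hm h0 hac hab hbc h3 (by linarith only [hsum]) (by linarith only [gc])
          (by linarith only [gb]) (by linarith only [hHa]) (by linarith only [hSig])
      · -- `β ≤ α ≤ γ`: roles `(c, a, b)`
        have hm : α + β - α * β < γ + 1 / 40 ∨ γ + β - γ * β < α + 1 / 40 ∨ γ + α - γ * α < β + 1 / 40 := by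
          rcases hmargin with h | h | h
          · exact Or.inr (Or.inl (by linarith only [h]))
          · exact Or.inr (Or.inr (by linarith only [h]))
          · exact Or.inl h
        exact hCollar_residual_false_sorted_quarter κ γ α β U0 Uac Ubc Uab U3 hκ hγ1 hβ0 hαγ hβα hbig.rotate.rotate
          hsmall.rotate.rotate hm h0 hac hbc hab h3 (by linarith only [hsum]) (by linarith only [ga])
          (by linarith only [gb]) (by linarith only [hHc]) (by linarith only [hSig])
  · rcases le_total γ α with hγα | hαγ
    · -- `γ ≤ α ≤ β`: roles `(b, a, c)`
      have hm : α + γ - α * γ < β + 1 / 40 ∨ β + γ - β * γ < α + 1 / 40 ∨ β + α - β * α < γ + 1 / 40 := by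
        rcases hmargin with h | h | h
        · exact Or.inr (Or.inl h)
        · exact Or.inl h
        · exact Or.inr (Or.inr (by linarith only [h]))
      exact hCollar_residual_false_sorted_quarter κ β α γ U0 Uab Ubc Uac U3 hκ hβ1 hγ0 hαβ hγα (or_left_comm.mp hbig)
        (or_left_comm.mp hsmall) hm h0 hab hbc hac h3 (by linarith only [hsum]) (by linarith only [ga])
        (by linarith only [gc]) (by linarith only [hHb]) (by linarith only [hSig])
    · rcases le_total γ β with hγβ | hβγ
      · -- `α ≤ γ ≤ β`: roles `(b, c, a)`
        have hm : γ + α - γ * α < β + 1 / 40 ∨ β + α - β * α < γ + 1 / 40 ∨ β + γ - β * γ < α + 1 / 40 := by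
          rcases hmargin with h | h | h
          · exact Or.inr (Or.inr h)
          · exact Or.inl (by linarith only [h])
          · exact Or.inr (Or.inl (by linarith only [h]))
        exact hCollar_residual_false_sorted_quarter κ β γ α U0 Ubc Uab Uac U3 hκ hβ1 hα0 hγβ hαγ hbig.rotate hsmall.rotate hm h0
          hbc hab hac h3 (by linarith only [hsum]) (by linarith only [gc]) (by linarith only [ga])
          (by linarith only [hHb]) (by linarith only [hSig])
      · -- `α ≤ β ≤ γ`: roles `(c, b, a)`
        have hm : β + α - β * α < γ + 1 / 40 ∨ γ + α - γ * α < β + 1 / 40 ∨ γ + β - γ * β < α + 1 / 40 := by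
          rcases hmargin with h | h | h
          · exact Or.inr (Or.inr (by linarith only [h]))
          · exact Or.inr (Or.inl (by linarith only [h]))
          · exact Or.inl (by linarith only [h])
        exact hCollar_residual_false_sorted_quarter κ γ β α U0 Ubc Uac Uab U3 hκ hγ1 hα0 hβγ hαβ
          (hbig.rotate.rotate.imp_right Or.symm) (hsmall.rotate.rotate.imp_right Or.symm) hm h0 hbc hac hab h3
          (by linarith only [hsum]) (by linarith only [gb]) (by linarith only [ga]) (by linarith only [hHc])
          (by linarith only [hSig])

/-! ### The theorem at a three-port observer -/

/-- **`Z(3,2)` at every three-port observer from the linear three-cluster row H_κ, `κ ≥ 1/4`.**  Let `o` be a three-port observer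
onto `a, b, c` (pairs at `o` other than `o–a, o–b, o–c` have weight `0`) of an arbitrary finite weighted graph, and suppose the
off-`o` three-point law of `(a, b, c)` satisfies the three linear three-cluster rows
`κ · P(v ↔ {u,w}) · P(u ↮ w) ≤ P({v↔u ∨ v↔w} ∩ {u↮w})` (apexes `v = a, b, c`, connections in `ω ∖ {edges at o}`) for some
`κ ≥ 1/4`.  If `Σ_v μ(o↔v) > 2` and `t ≥ μ(o↮v)` for `v = a, b, c`, then `μ{o reaches at most one of a, b, c} ≤ t`.
Final map (`le_one_reached_le_threePort`) off the collar; on the collar the cell solver `hCollar_residual_false` through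
`le_one_reached_le_of_cellSolverH` (κ₀ = 1/4 version of `le_one_reached_le_of_H`). [this work] -/
theorem le_one_reached_le_of_H_quarter (κ : ℝ) (hκ : 1 / 4 ≤ κ) (w : Sym2 (Fin n) → unitInterval) (R : Finset (Fin n))
    (o a b c : Fin n) (t : ℝ)
    (hR : R = {a, b, c}) (hao : a ≠ o) (hbo : b ≠ o) (hco : c ≠ o) (hab : a ≠ b) (hac : a ≠ c) (hbc : b ≠ c)
    (hobs : ∀ u, u ≠ o → u ≠ a → u ≠ b → u ≠ c → w s(o, u) = 0)
    (hHa : κ * ((prodBernoulli w).real {ω | (openGraph (ω ∩ {e | o ∉ e})).Reachable a b ∧ ¬ (openGraph (ω ∩ {e | o ∉ e})).Reachable a c} +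
        (prodBernoulli w).real {ω | (openGraph (ω ∩ {e | o ∉ e})).Reachable a c ∧ ¬ (openGraph (ω ∩ {e | o ∉ e})).Reachable a b} +
        (prodBernoulli w).real {ω | (openGraph (ω ∩ {e | o ∉ e})).Reachable a b ∧ (openGraph (ω ∩ {e | o ∉ e})).Reachable a c}) *
      ((prodBernoulli w).real {ω | ¬ (openGraph (ω ∩ {e | o ∉ e})).Reachable a b ∧ ¬ (openGraph (ω ∩ {e | o ∉ e})).Reachable a c ∧ ¬ (openGraph (ω ∩ {e | o ∉ e})).Reachable b c} +
        (prodBernoulli w).real {ω | (openGraph (ω ∩ {e | o ∉ e})).Reachable a b ∧ ¬ (openGraph (ω ∩ {e | o ∉ e})).Reachable a c} +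
        (prodBernoulli w).real {ω | (openGraph (ω ∩ {e | o ∉ e})).Reachable a c ∧ ¬ (openGraph (ω ∩ {e | o ∉ e})).Reachable a b}) ≤
      (prodBernoulli w).real {ω | (openGraph (ω ∩ {e | o ∉ e})).Reachable a b ∧ ¬ (openGraph (ω ∩ {e | o ∉ e})).Reachable a c} +
        (prodBernoulli w).real {ω | (openGraph (ω ∩ {e | o ∉ e})).Reachable a c ∧ ¬ (openGraph (ω ∩ {e | o ∉ e})).Reachable a b})
    (hHb : κ * ((prodBernoulli w).real {ω | (openGraph (ω ∩ {e | o ∉ e})).Reachable a b ∧ ¬ (openGraph (ω ∩ {e | o ∉ e})).Reachable a c} +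
        (prodBernoulli w).real {ω | (openGraph (ω ∩ {e | o ∉ e})).Reachable b c ∧ ¬ (openGraph (ω ∩ {e | o ∉ e})).Reachable a b} +
        (prodBernoulli w).real {ω | (openGraph (ω ∩ {e | o ∉ e})).Reachable a b ∧ (openGraph (ω ∩ {e | o ∉ e})).Reachable a c}) *
      ((prodBernoulli w).real {ω | ¬ (openGraph (ω ∩ {e | o ∉ e})).Reachable a b ∧ ¬ (openGraph (ω ∩ {e | o ∉ e})).Reachable a c ∧ ¬ (openGraph (ω ∩ {e | o ∉ e})).Reachable b c} +
        (prodBernoulli w).real {ω | (openGraph (ω ∩ {e | o ∉ e})).Reachable a b ∧ ¬ (openGraph (ω ∩ {e | o ∉ e})).Reachable a c} +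
        (prodBernoulli w).real {ω | (openGraph (ω ∩ {e | o ∉ e})).Reachable b c ∧ ¬ (openGraph (ω ∩ {e | o ∉ e})).Reachable a b}) ≤
      (prodBernoulli w).real {ω | (openGraph (ω ∩ {e | o ∉ e})).Reachable a b ∧ ¬ (openGraph (ω ∩ {e | o ∉ e})).Reachable a c} +
        (prodBernoulli w).real {ω | (openGraph (ω ∩ {e | o ∉ e})).Reachable b c ∧ ¬ (openGraph (ω ∩ {e | o ∉ e})).Reachable a b})
    (hHc : κ * ((prodBernoulli w).real {ω | (openGraph (ω ∩ {e | o ∉ e})).Reachable a c ∧ ¬ (openGraph (ω ∩ {e | o ∉ e})).Reachable a b} +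
        (prodBernoulli w).real {ω | (openGraph (ω ∩ {e | o ∉ e})).Reachable b c ∧ ¬ (openGraph (ω ∩ {e | o ∉ e})).Reachable a b} +
        (prodBernoulli w).real {ω | (openGraph (ω ∩ {e | o ∉ e})).Reachable a b ∧ (openGraph (ω ∩ {e | o ∉ e})).Reachable a c}) *
      ((prodBernoulli w).real {ω | ¬ (openGraph (ω ∩ {e | o ∉ e})).Reachable a b ∧ ¬ (openGraph (ω ∩ {e | o ∉ e})).Reachable a c ∧ ¬ (openGraph (ω ∩ {e | o ∉ e})).Reachable b c} +
        (prodBernoulli w).real {ω | (openGraph (ω ∩ {e | o ∉ e})).Reachable a c ∧ ¬ (openGraph (ω ∩ {e | o ∉ e})).Reachable a b} +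
        (prodBernoulli w).real {ω | (openGraph (ω ∩ {e | o ∉ e})).Reachable b c ∧ ¬ (openGraph (ω ∩ {e | o ∉ e})).Reachable a b}) ≤
      (prodBernoulli w).real {ω | (openGraph (ω ∩ {e | o ∉ e})).Reachable a c ∧ ¬ (openGraph (ω ∩ {e | o ∉ e})).Reachable a b} +
        (prodBernoulli w).real {ω | (openGraph (ω ∩ {e | o ∉ e})).Reachable b c ∧ ¬ (openGraph (ω ∩ {e | o ∉ e})).Reachable a b})
    (hsum : 2 < (prodBernoulli w).real (openConn o a) + (prodBernoulli w).real (openConn o b) +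
      (prodBernoulli w).real (openConn o c))
    (hta : (prodBernoulli w).real (openConn o a)ᶜ ≤ t) (htb : (prodBernoulli w).real (openConn o b)ᶜ ≤ t)
    (htc : (prodBernoulli w).real (openConn o c)ᶜ ≤ t) :
    (prodBernoulli w).real {ω : BondConfig (Fin n) | (R.filter fun v => ω ∈ openConn o v).card ≤ 1} ≤ t := by
  -- the final-map region (p1 g5)
  by_cases hhalf : (1 / 2 : ℝ) ≤ w s(o, a) ∨ (1 / 2 : ℝ) ≤ w s(o, b) ∨ (1 / 2 : ℝ) ≤ w s(o, c)
  · exact le_one_reached_le_threePort w R o a b c t hR hao hbo hco hab hac hbc hobs (Or.inl hhalf) hsum hta htb htc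
  by_cases hlo : (3 / 10 : ℝ) ≤ w s(o, a) ∧ (3 / 10 : ℝ) ≤ w s(o, b) ∧ (3 / 10 : ℝ) ≤ w s(o, c)
  · exact le_one_reached_le_threePort w R o a b c t hR hao hbo hco hab hac hbc hobs (Or.inr (Or.inl hlo)) hsum hta htb htc
  by_cases hhi : (w s(o, a) : ℝ) ≤ 2 / 5 ∧ (w s(o, b) : ℝ) ≤ 2 / 5 ∧ (w s(o, c) : ℝ) ≤ 2 / 5
  · exact le_one_reached_le_threePort w R o a b c t hR hao hbo hco hab hac hbc hobs (Or.inr (Or.inr (Or.inl hhi))) hsum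
      hta htb htc
  by_cases hV : (w s(o, a) : ℝ) + 1 / 40 ≤ w s(o, b) + w s(o, c) - w s(o, b) * w s(o, c) ∧
      (w s(o, b) : ℝ) + 1 / 40 ≤ w s(o, a) + w s(o, c) - w s(o, a) * w s(o, c) ∧
      (w s(o, c) : ℝ) + 1 / 40 ≤ w s(o, a) + w s(o, b) - w s(o, a) * w s(o, b)
  · exact le_one_reached_le_threePort w R o a b c t hR hao hbo hco hab hac hbc hobs (Or.inr (Or.inr (Or.inr hV))) hsum
      hta htb htc
  -- the collar
  push Not at hhalf
  have hbig : (2 / 5 : ℝ) < w s(o, a) ∨ (2 / 5 : ℝ) < w s(o, b) ∨ (2 / 5 : ℝ) < w s(o, c) := by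
    by_contra h
    push Not at h
    exact hhi h
  have hsmall : (w s(o, a) : ℝ) < 3 / 10 ∨ (w s(o, b) : ℝ) < 3 / 10 ∨ (w s(o, c) : ℝ) < 3 / 10 := by
    by_contra h
    push Not at h
    exact hlo h
  have hmargin : (w s(o, b) : ℝ) + w s(o, c) - w s(o, b) * w s(o, c) < w s(o, a) + 1 / 40 ∨
      (w s(o, a) : ℝ) + w s(o, c) - w s(o, a) * w s(o, c) < w s(o, b) + 1 / 40 ∨
      (w s(o, a) : ℝ) + w s(o, b) - w s(o, a) * w s(o, b) < w s(o, c) + 1 / 40 := by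
    by_contra h
    push Not at h
    exact hV h
  exact le_one_reached_le_of_cellSolverH κ w R o a b c t hR hao hbo hco hab hac hbc hobs
    (fun U0 Uab Uac Ubc U3 h0 hab' hac' hbc' h3 hs ga gb gc _ _ _ hHa' hHb' hHc' hSig =>
      hCollar_residual_false_quarter κ _ _ _ U0 Uab Uac Ubc U3 hκ (w s(o, a)).2.1 hhalf.1.le (w s(o, b)).2.1 hhalf.2.1.le
        (w s(o, c)).2.1 hhalf.2.2.le hbig hsmall hmargin h0 hab' hac' hbc' h3 hs ga gb gc hHa' hHb' hHc' hSig)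
    hHa hHb hHc hsum hta htb htc

/-! ### From the product row with constant 3 -/

/-- The product row `U3·U0 ≤ C·S` (F1_C, `S = Uab+Uac`) with `C ≤ 3` implies the linear row H_{1/4}:
`(S+U3)(S+U0) = S(S+U0+U3) + U3·U0 ≤ S + 3S`. [this work] -/
theorem hRow_quarter_of_productRow3 (C U0 Uab Uac Ubc U3 : ℝ) (hC : C ≤ 3) (hab : 0 ≤ Uab) (hac : 0 ≤ Uac)
    (hbc : 0 ≤ Ubc) (hsum : Uab + Uac + Ubc + U3 + U0 = 1)
    (hP : U3 * U0 ≤ C * (Uab + Uac)) :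
    1 / 4 * (Uab + Uac + U3) * (U0 + Uab + Uac) ≤ Uab + Uac := by
  have hle : Uab + Uac + U0 + U3 ≤ 1 := by linarith only [hsum, hbc]
  have h1 : (Uab + Uac) * (Uab + Uac + U0 + U3) ≤ (Uab + Uac) * 1 :=
    mul_le_mul_of_nonneg_left hle (by linarith only [hab, hac])
  have h2 : U3 * U0 ≤ 3 * (Uab + Uac) := by nlinarith only [hP, hC, hab, hac]
  have e : (Uab + Uac + U3) * (U0 + Uab + Uac) = (Uab + Uac) * (Uab + Uac + U0 + U3) + U3 * U0 := by ring
  have : (Uab + Uac + U3) * (U0 + Uab + Uac) ≤ 4 * (Uab + Uac) := by rw [e]; linarith only [h1, h2]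
  linarith only [this]

/-- **`Z(3,2)` at every three-port observer from the product row `P(a↔b↔c)·P(a|b|c) ≤ C·P(exactly one)`, `C ≤ 3`.**  Let `o` be a three-port observer onto
`a, b, c` of an arbitrary finite weighted graph whose off-`o` three-point law of `(a,b,c)` satisfies, at each apex `v ∈ {a,b,c}`,
`P(a↔b↔c) · P(a, b, c pairwise separated) ≤ C · P(v joined to exactly one of the other two)` (connections in `ω ∖ {edges at o}`).
If `Σ_v μ(o↔v) > 2` and `t ≥ μ(o↮v)` (`v = a,b,c`) then `μ{o reaches at most one of a,b,c} ≤ t`. [this work] -/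
theorem le_one_reached_le_of_productRow3 (C : ℝ) (hC : C ≤ 3) (w : Sym2 (Fin n) → unitInterval) (R : Finset (Fin n))
    (o a b c : Fin n) (t : ℝ)
    (hR : R = {a, b, c}) (hao : a ≠ o) (hbo : b ≠ o) (hco : c ≠ o) (hab : a ≠ b) (hac : a ≠ c) (hbc : b ≠ c)
    (hobs : ∀ u, u ≠ o → u ≠ a → u ≠ b → u ≠ c → w s(o, u) = 0)
    (hPa : (prodBernoulli w).real {ω | (openGraph (ω ∩ {e | o ∉ e})).Reachable a b ∧ (openGraph (ω ∩ {e | o ∉ e})).Reachable a c} *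
      (prodBernoulli w).real {ω | ¬ (openGraph (ω ∩ {e | o ∉ e})).Reachable a b ∧ ¬ (openGraph (ω ∩ {e | o ∉ e})).Reachable a c ∧ ¬ (openGraph (ω ∩ {e | o ∉ e})).Reachable b c} ≤
      C * ((prodBernoulli w).real {ω | (openGraph (ω ∩ {e | o ∉ e})).Reachable a b ∧ ¬ (openGraph (ω ∩ {e | o ∉ e})).Reachable a c} +
        (prodBernoulli w).real {ω | (openGraph (ω ∩ {e | o ∉ e})).Reachable a c ∧ ¬ (openGraph (ω ∩ {e | o ∉ e})).Reachable a b}))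
    (hPb : (prodBernoulli w).real {ω | (openGraph (ω ∩ {e | o ∉ e})).Reachable a b ∧ (openGraph (ω ∩ {e | o ∉ e})).Reachable a c} *
      (prodBernoulli w).real {ω | ¬ (openGraph (ω ∩ {e | o ∉ e})).Reachable a b ∧ ¬ (openGraph (ω ∩ {e | o ∉ e})).Reachable a c ∧ ¬ (openGraph (ω ∩ {e | o ∉ e})).Reachable b c} ≤
      C * ((prodBernoulli w).real {ω | (openGraph (ω ∩ {e | o ∉ e})).Reachable a b ∧ ¬ (openGraph (ω ∩ {e | o ∉ e})).Reachable a c} +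
        (prodBernoulli w).real {ω | (openGraph (ω ∩ {e | o ∉ e})).Reachable b c ∧ ¬ (openGraph (ω ∩ {e | o ∉ e})).Reachable a b}))
    (hPc : (prodBernoulli w).real {ω | (openGraph (ω ∩ {e | o ∉ e})).Reachable a b ∧ (openGraph (ω ∩ {e | o ∉ e})).Reachable a c} *
      (prodBernoulli w).real {ω | ¬ (openGraph (ω ∩ {e | o ∉ e})).Reachable a b ∧ ¬ (openGraph (ω ∩ {e | o ∉ e})).Reachable a c ∧ ¬ (openGraph (ω ∩ {e | o ∉ e})).Reachable b c} ≤
      C * ((prodBernoulli w).real {ω | (openGraph (ω ∩ {e | o ∉ e})).Reachable a c ∧ ¬ (openGraph (ω ∩ {e | o ∉ e})).Reachable a b} +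
        (prodBernoulli w).real {ω | (openGraph (ω ∩ {e | o ∉ e})).Reachable b c ∧ ¬ (openGraph (ω ∩ {e | o ∉ e})).Reachable a b}))
    (hsum : 2 < (prodBernoulli w).real (openConn o a) + (prodBernoulli w).real (openConn o b) +
      (prodBernoulli w).real (openConn o c))
    (hta : (prodBernoulli w).real (openConn o a)ᶜ ≤ t) (htb : (prodBernoulli w).real (openConn o b)ᶜ ≤ t)
    (htc : (prodBernoulli w).real (openConn o c)ᶜ ≤ t) :
    (prodBernoulli w).real {ω : BondConfig (Fin n) | (R.filter fun v => ω ∈ openConn o v).card ≤ 1} ≤ t := by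
  set μ := prodBernoulli w with hμ
  set Uab := μ.real {ω | (openGraph (ω ∩ {e | o ∉ e})).Reachable a b ∧ ¬ (openGraph (ω ∩ {e | o ∉ e})).Reachable a c} with hUab
  set Uac := μ.real {ω | (openGraph (ω ∩ {e | o ∉ e})).Reachable a c ∧ ¬ (openGraph (ω ∩ {e | o ∉ e})).Reachable a b} with hUac
  set Ubc := μ.real {ω | (openGraph (ω ∩ {e | o ∉ e})).Reachable b c ∧ ¬ (openGraph (ω ∩ {e | o ∉ e})).Reachable a b} with hUbc
  set U3 := μ.real {ω | (openGraph (ω ∩ {e | o ∉ e})).Reachable a b ∧ (openGraph (ω ∩ {e | o ∉ e})).Reachable a c} with hU3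
  set U0 := μ.real {ω | ¬ (openGraph (ω ∩ {e | o ∉ e})).Reachable a b ∧
    ¬ (openGraph (ω ∩ {e | o ∉ e})).Reachable a c ∧ ¬ (openGraph (ω ∩ {e | o ∉ e})).Reachable b c} with hU0
  have hcells : Uab + Uac + Ubc + U3 + U0 = 1 := cells_sum_eq_one w o a b c
  have hab' : 0 ≤ Uab := measureReal_nonneg
  have hac' : 0 ≤ Uac := measureReal_nonneg
  have hbc' : 0 ≤ Ubc := measureReal_nonneg
  have hHa : 1 / 4 * (Uab + Uac + U3) * (U0 + Uab + Uac) ≤ Uab + Uac :=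
    hRow_quarter_of_productRow3 C U0 Uab Uac Ubc U3 hC hab' hac' hbc' hcells hPa
  have hHb : 1 / 4 * (Uab + Ubc + U3) * (U0 + Uab + Ubc) ≤ Uab + Ubc :=
    hRow_quarter_of_productRow3 C U0 Uab Ubc Uac U3 hC hab' hbc' hac' (by linarith only [hcells]) hPb
  have hHc : 1 / 4 * (Uac + Ubc + U3) * (U0 + Uac + Ubc) ≤ Uac + Ubc :=
    hRow_quarter_of_productRow3 C U0 Uac Ubc Uab U3 hC hac' hbc' hab' (by linarith only [hcells]) hPc
  exact le_one_reached_le_of_H_quarter (1 / 4) le_rfl w R o a b c t hR hao hbo hco hab hac hbc hobs hHa hHb hHc hsum hta htb htc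

end ThreePort

end Summit.CriticalPhenomena.PercolationContinuityZ3.Theorems

end
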